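import Summits.BirchSwinnertonDyer.Rank1Residual.GaloisImage.KuriharaLowerBoundThreeOfKolyvaginProductAt
import HarnessLib

/-!
# The (a′) END theorem at `p = 3` with the deep family NESTED ONLY ABOVE THE SHALLOW DEPTH
# (route W2 `KimAtThreeKolyvagin`, crux `DeepLowerAtThree` = item stmt-BirchSwinnertonDyer-19075; cell `bsd-addord`,
# seat kim3 gen 8; ONE-BINDER variants of cell `b2b-bsdres` / team n1011's `Assembly.padicValRat_le_of_certificate_of_transport_at`
# and `Assembly.padicValRat_le_of_kolyvaginProduct_at`, adapted from
# `Rank1Residual/GaloisImage/KuriharaLowerBoundThreeOf{Transport,KolyvaginProduct}At.lean` (credit n1011-p18/p03/p11; not edited)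

HONEST FRAMING. TOOL theorems only: no definition, no named fact, no `sorry`; nothing asserted, nothing booked, no
mark moved. CONDITIONAL exactly as the n1011 originals (the `P`-keyed two-level dictionary
`KatoKuriharaDictionaryThreeAt₂At` — FLAG `K22-Thm3.13-PORT@3` —, the [S24] Thm. 4.4 (1)(2) instances at every level
of the shallow and deep data, the Poitou–Tate families, `hEP`).

WHAT AND WHY. The n1011 END theorems quantify the nesting hypothesis of the deep family over ALL depths,
`hPP' : ∀ k′, (D′ k′).primes ⊆ D.primes`, but consume it only at `k′ ≥ k` (the scalar transport
`Transport.pow_dvd_iff_of_comp` is invoked under `k ≤ k′`; the Selmer group is read at the one deep level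
`k′ = max k (X + t + v)`).  For a shallow datum PINNED at depth `k > 0` the repaired shared-generator tower family
(`TowerPackage.exists_towerFamily_with`: classes pinned at every depth) is nested for `k′ ≥ k`
(`FrobShape.frobeniusClassPrimes_pow_mul_subset_of_le`) but NOT for `k′ < k` (deeper classes are smaller), so the
all-depths binder cannot be met from the PRINTED-shape [S24] facts at `k > 0` — and `k ≥ j − 1` is forced by a
certificate modulo `3^j`.  Here the two theorems are re-proved with the binder weakened to
`∀ k′, k ≤ k′ → (D′ k′).primes ⊆ D.primes` (one token at the one use site; every other line verbatim) — what the
`∂`-currency road to crux 19075 at every certificate depth needs (sequel `KimAtThreeKolyvaginDeepLowerKatoStratum.lean`).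
References: [Kim2022StructureSelmer] Thm. 1.9 (6), 3.13; [Sakamoto2024] Thm. 4.4; [MazurRubin2004] 3.2.4, 4.4.1, (33).
-/

set_option autoImplicit false
-- the Theorems namespace of a single-conjunct summit repeats the summit name by design (D-0017)
set_option linter.dupNamespace false

noncomputable section

open scoped Classical NumberField ContRepresentation
open Function Field NumberField IsDedekindDomain IsDedekindDomain.HeightOneSpectrum WeierstrassCurve
  Literature.NumberTheory.EllipticCurves Literature.NumberTheory.EllipticCurves.ModularForms
  Literature.NumberTheory.EllipticCurves.Rank1Residual
  Literature.NumberTheory.GaloisRepresentations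
  Literature.NumberTheory.GaloisRepresentations.DiscreteGaloisModule Literature.NumberTheory.GaloisCohomology
  Summit.BirchSwinnertonDyer.Rank1Residual.GaloisImage
  Summit.BirchSwinnertonDyer.Rank1Residual.GaloisImage.Assembly

namespace Summit.BirchSwinnertonDyer.BirchSwinnertonDyer.Theorems.KimAtThreeKolyvaginDeepLowerNestedEnd

/-- **n1011's `Assembly.padicValRat_le_of_certificate_of_transport_at` with the deep-family nesting
binder restricted to depths `k′ ≥ k`** (`hPP' : ∀ k′, k ≤ k′ → (D′ k′).primes ⊆ D.primes`); statement
and proof otherwise verbatim (the one use site `Transport.pow_dvd_iff_of_comp … (hPP' k′ hk′) …` sits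
under `k ≤ k′`).  (C20) at `p = 3` in datum currency, transport and level counts discharged — the END
theorem of sub-route (a′) modulo the `P`-keyed dictionary, the [S24] (1)(2) instances at every level of
the shallow and deep data, the Poitou–Tate families and `hEP` (adapted from
`Rank1Residual/GaloisImage/KuriharaLowerBoundThreeOfTransportAt.lean`, credit cell b2b-bsdres n1011).
[cite: Kim2022StructureSelmer, Thm. 1.9 (6) and Thm. 3.13] [cite: Sakamoto2024, Thm. 4.4 (p. 926)]
[cite: MazurRubin2004, Thm. 3.2.4, Thm. 4.4.1 and App. A (33)] -/
theorem padicValRat_le_of_certificate_of_transport_nested_at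
    (W : WeierstrassCurve ℚ) [W.IsElliptic] [W.IsGloballyMinimal] (t k : ℕ)
    (D : KolyvaginDatum (W.torsionGaloisModule (((3 : ℕ) : ℤ) ^ k * ((3 : ℕ) : ℤ))))
    (v₃ : HeightOneSpectrum (𝓞 ℚ)) (hv₃ : ((3 : ℕ) : 𝓞 ℚ) ∈ v₃.asIdeal)
    -- the row
    (hadd : Addv W 3) (hc3 : ¬ 3 ∣ (W.baseChange ℚ_[3]).localTamagawaNumber ℤ_[3])
    (hsurj : W.HasSurjectiveModNGaloisRep ((3 : ℕ) : ℤ))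
    (ht : Nat.card {Q : (W.baseChange ℚ_[3]).toAffine.Point // (3 : ℕ) • Q = 0} = 3 ^ t)
    (hL : W.entireLFunction 1 ≠ 0) [Finite W.toAffine.Point] [Finite W.sha]
    {N : ℕ} [NeZero N] (P : ModularParametrizationData W N) (hcP : ¬ ((3 : ℕ) : ℤ) ∣ P.maninConstant)
    (hper : ∃ u : ℚ, ‖(u : ℚ_[3])‖ = 1 ∧ W.realPeriodRat = u * plusPeriod P.f)
    -- the shallow datum: cyclotomic transverse condition, a generator `g` of `KS₁`, and Sakamoto's
    -- Thm. 4.4 (2) in ORDER form at every level (R1-22 instance)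
    (hDT : D.transverse = cyclotomicTransverse _)
    (g : Finset (HeightOneSpectrum (𝓞 ℚ)) →
      galoisCohomology (W.torsionGaloisModule (((3 : ℕ) : ℤ) ^ k * ((3 : ℕ) : ℤ))) 1)
    (hg : g ∈ D.kolyvaginSystems (propagatedSelmerStructure W 3 k))
    (hgen : ∀ κ ∈ D.kolyvaginSystems (propagatedSelmerStructure W 3 k), ∃ a : ℕ, κ = a • g)
    -- the deep inputs, at every depth `k′`
    (D' : ∀ k' : ℕ, KolyvaginDatum (W.torsionGaloisModule (((3 : ℕ) : ℤ) ^ k' * ((3 : ℕ) : ℤ))))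
    (hDT' : ∀ k', (D' k').transverse = cyclotomicTransverse _)
    (hPP' : ∀ k', k ≤ k' → (D' k').primes ⊆ D.primes)
    (red : ∀ k' : ℕ, (W.torsionGaloisModule (((3 : ℕ) : ℤ) ^ k' * ((3 : ℕ) : ℤ))).toContRepresentation
      →ⁱL (W.torsionGaloisModule (((3 : ℕ) : ℤ) ^ k * ((3 : ℕ) : ℤ))).toContRepresentation)
    (hred : ∀ k', ∀ x : geomTorsion W (((3 : ℕ) : ℤ) ^ k' * ((3 : ℕ) : ℤ)),
      ((red k' x : geomTorsion W (((3 : ℕ) : ℤ) ^ k * ((3 : ℕ) : ℤ))) : geomPoints W) =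
        (((3 : ℕ) : ℤ) ^ (k' - k)) • (x : geomPoints W))
    (hdict : ∀ k', k ≤ k' → KatoKuriharaDictionaryThreeAt₂At W t k k' D (D' k') (red k') v₃ P)
    (g' : ∀ k' : ℕ, Finset (HeightOneSpectrum (𝓞 ℚ)) →
      galoisCohomology (W.torsionGaloisModule (((3 : ℕ) : ℤ) ^ k' * ((3 : ℕ) : ℤ))) 1)
    (hg' : ∀ k', g' k' ∈ (D' k').kolyvaginSystems (propagatedSelmerStructure W 3 k'))
    (hgo' : ∀ k', addOrderOf (g' k') = 3 ^ (k' + 1))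
    (hgen' : ∀ k', ∀ κ ∈ (D' k').kolyvaginSystems (propagatedSelmerStructure W 3 k'),
      ∃ a : ℕ, κ = a • g' k')
    (inv' : ∀ k' : ℕ, LocalInvariants ℚ (3 ^ (k' + 1))) (hperf' : ∀ k', (inv' k').IsPerfect)
    (hsum' : ∀ k', (inv' k').SumLocalTermEqZero) (hcompl' : ∀ k', (inv' k').SelmerComplement)
    (hinj' : ∀ k', ∀ v : HeightOneSpectrum (𝓞 ℚ), Injective (inv' k' (Sum.inr v)))
    (hEP : ∀ v : HeightOneSpectrum (𝓞 ℚ), localEulerPoincareCharacteristic (v.adicCompletion ℚ))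
    (T : ∀ k' : ℕ, Finset (HeightOneSpectrum (𝓞 ℚ))) (hv₃T : ∀ k', v₃ ∈ T k')
    (hT : ∀ k', ∀ v : HeightOneSpectrum (𝓞 ℚ), v ∉ T k' →
      (((3 ^ (k' + 1) : ℕ) : ℕ) : 𝓞 ℚ) ∉ v.asIdeal ∧
        GaloisRep.IsUnramifiedAt v (W.torsionGaloisModule (((3 : ℕ) : ℤ) ^ k' * ((3 : ℕ) : ℤ))))
    (h𝓕T : ∀ k', (propagatedSelmerStructure W 3 k').IsUnramifiedOutside (finSupport (T k')))
    (h𝓚T : ∀ k', (W.kummerSelmerStructure (((3 : ℕ) : ℤ) ^ k' * ((3 : ℕ) : ℤ))).IsUnramifiedOutside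
      (finSupport (T k')))
    (hfinT : ∀ k', Finite (geomTorsion W (((3 : ℕ) : ℤ) ^ k' * ((3 : ℕ) : ℤ))))
    (hfinS : ∀ k', Finite (W.kummerSelmerStructure (((3 : ℕ) : ℤ) ^ k' * ((3 : ℕ) : ℤ))).selmerGroup)
    -- the primes of the data lie off the admissible sets and have Rubin's local shape
    (hPS : ∀ q ∈ D.primes, q ∉ T k) (hPS' : ∀ k', ∀ q ∈ (D' k').primes, q ∉ T k')
    (hUT : ∀ q ∈ D.primes,
      Nat.card (unramifiedSubgroup (GaloisRep.toLocal q
        (W.torsionGaloisModule (((3 : ℕ) : ℤ) ^ k * ((3 : ℕ) : ℤ)))) 1) =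
        Nat.card (D.transverse (Sum.inr q)))
    (hUT' : ∀ k', ∀ q ∈ (D' k').primes,
      Nat.card (unramifiedSubgroup (GaloisRep.toLocal q
        (W.torsionGaloisModule (((3 : ℕ) : ℤ) ^ k' * ((3 : ℕ) : ℤ)))) 1) =
        Nat.card ((D' k').transverse (Sum.inr q)))
    -- Sakamoto's Thm. 4.4 (2) in ORDER form at every level, shallow and deep (R1-22 / S24-DEEP)
    (hR22D : ∀ d, D.IsLevel d →
      (Nat.card ((inv' k).dualSelmerStructure _
          (D.atLevel (propagatedSelmerStructure W 3 k) d)).selmerGroup ∣ 3 ^ (k + 1) →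
        addOrderOf (g d) * Nat.card ((inv' k).dualSelmerStructure _
          (D.atLevel (propagatedSelmerStructure W 3 k) d)).selmerGroup = 3 ^ (k + 1)) ∧
      (3 ^ (k + 1) ∣ Nat.card ((inv' k).dualSelmerStructure _
          (D.atLevel (propagatedSelmerStructure W 3 k) d)).selmerGroup → g d = 0))
    (hR22' : ∀ k' d, (D' k').IsLevel d →
      (Nat.card ((inv' k').dualSelmerStructure _
          ((D' k').atLevel (propagatedSelmerStructure W 3 k') d)).selmerGroup ∣ 3 ^ (k' + 1) →
        addOrderOf (g' k' d) * Nat.card ((inv' k').dualSelmerStructure _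
          ((D' k').atLevel (propagatedSelmerStructure W 3 k') d)).selmerGroup = 3 ^ (k' + 1)) ∧
      (3 ^ (k' + 1) ∣ Nat.card ((inv' k').dualSelmerStructure _
          ((D' k').atLevel (propagatedSelmerStructure W 3 k') d)).selmerGroup → g' k' d = 0))
    -- the certificate at a level `n` of `D`
    (n : Finset (HeightOneSpectrum (𝓞 ℚ))) (hn : D.IsLevel n) {j : ℕ} (htj : t + j ≤ k + 1)
    (hPN : ∀ q ∈ n, (Ideal.absNorm q.asIdeal).Coprime N)
    {ψ₀ : (ℓ : ℕ) → (ZMod ℓ)ˣ →* Multiplicative (ZMod (3 ^ j))}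
    (hψ₀ : ∀ q ∈ n, Function.Surjective (ψ₀ (Ideal.absNorm q.asIdeal)))
    (hcert : haveI : NeZero (∏ q ∈ n, Ideal.absNorm q.asIdeal) :=
        ⟨Finset.prod_ne_zero_iff.2 fun q _ => absNorm_ne_zero q⟩
      kuriharaNumber P.f (3 ^ j) (∏ q ∈ n, Ideal.absNorm q.asIdeal) ψ₀ ≠ 0)
    (hv : ∀ c, c ⊂ n → c.Nonempty → ∀ ψ' : (ℓ : ℕ) → (ZMod ℓ)ˣ →* Multiplicative (ZMod (3 ^ j)),
      (∀ q ∈ c, Function.Surjective (ψ' (Ideal.absNorm q.asIdeal))) →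
        haveI : NeZero (∏ q ∈ c, Ideal.absNorm q.asIdeal) :=
          ⟨Finset.prod_ne_zero_iff.2 fun q _ => absNorm_ne_zero q⟩
        kuriharaNumber P.f (3 ^ j) (∏ q ∈ c, Ideal.absNorm q.asIdeal) ψ' = 0) :
    ∃ q : ℚ, W.entireLFunction 1 / (W.realPeriodRat : ℂ) = (q : ℂ) ∧
      padicValRat 3 q ≤
        (padicValNat 3 (Nat.card (AddCommGroup.primaryComponent W.sha 3)) : ℤ) + ((j - 1 : ℕ) : ℤ) := by
  haveI : Fact (Nat.Prime 3) := ⟨Nat.prime_three⟩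
  -- `hR22` at the empty level is the case `d = ∅` of `hR22'`
  have hR22 : ∀ k', (Nat.card ((inv' k').dualSelmerStructure
          (W.torsionGaloisModule (((3 : ℕ) : ℤ) ^ k' * ((3 : ℕ) : ℤ)))
          (propagatedSelmerStructure W 3 k')).selmerGroup ∣ 3 ^ (k' + 1) →
        addOrderOf (g' k' ∅) * Nat.card ((inv' k').dualSelmerStructure
          (W.torsionGaloisModule (((3 : ℕ) : ℤ) ^ k' * ((3 : ℕ) : ℤ)))
            (propagatedSelmerStructure W 3 k')).selmerGroup = 3 ^ (k' + 1)) ∧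
      (3 ^ (k' + 1) ∣ Nat.card ((inv' k').dualSelmerStructure
          (W.torsionGaloisModule (((3 : ℕ) : ℤ) ^ k' * ((3 : ℕ) : ℤ)))
            (propagatedSelmerStructure W 3 k')).selmerGroup → g' k' ∅ = 0) := by
    intro k'
    have h := hR22' k' ∅ (D' k').isLevel_empty
    have h0 : (D' k').atLevel (propagatedSelmerStructure W 3 k') ∅ =
        propagatedSelmerStructure W 3 k' := SelmerStructure.modify_empty _ _
    rw [h0] at h
    exact h
  -- `hNp`: the dual Selmer group of `𝓕_can` is a finite `3`-group
  have hNp : ∀ k', ∃ l, Nat.card ((inv' k').dualSelmerStructure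
      (W.torsionGaloisModule (((3 : ℕ) : ℤ) ^ k' * ((3 : ℕ) : ℤ)))
        (propagatedSelmerStructure W 3 k')).selmerGroup = 3 ^ l := by
    intro k'
    haveI := hfinT k'
    haveI := hfinS k'
    haveI : NeZero (3 ^ (k' + 1)) := ⟨pow_ne_zero _ three_ne_zero⟩
    have hKSD := DeepLedger.natCard_selmerGroup_kummer_eq_dual_of_eq W
      (((3 : ℕ) : ℤ) ^ k' * ((3 : ℕ) : ℤ)) (3 ^ (k' + 1)) (by push_cast; ring)
      (Nat.prime_three.isPrimePow.pow (Nat.succ_ne_zero k')) ((by decide : Odd 3).pow)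
      (inv' k') (hinj' k') hEP
    have hfinKd : Finite ((inv' k').dualSelmerStructure
        (W.torsionGaloisModule (((3 : ℕ) : ℤ) ^ k' * ((3 : ℕ) : ℤ)))
        (W.kummerSelmerStructure (((3 : ℕ) : ℤ) ^ k' * ((3 : ℕ) : ℤ)))).selmerGroup :=
      Nat.finite_of_card_ne_zero (by rw [← hKSD]; exact Nat.card_pos.ne')
    have hsub := (inv' k').selmerGroup_dualSelmerStructure_anti
      (W.torsionGaloisModule (((3 : ℕ) : ℤ) ^ k' * ((3 : ℕ) : ℤ)))
      (𝓕 := W.kummerSelmerStructure (((3 : ℕ) : ℤ) ^ k' * ((3 : ℕ) : ℤ)))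
      (𝓖 := propagatedSelmerStructure W 3 k')
      (fun v => kummerSelmerStructure_le_propagatedSelmerStructure W 3 v k')
    haveI : Finite ((inv' k').dualSelmerStructure
        (W.torsionGaloisModule (((3 : ℕ) : ℤ) ^ k' * ((3 : ℕ) : ℤ)))
        (propagatedSelmerStructure W 3 k')).selmerGroup :=
      Finite.of_injective (AddSubgroup.inclusion hsub) (AddSubgroup.inclusion_injective hsub)
    exact Transport.exists_natCard_eq_pow_of_nsmul_eq_zero (p := 3) (K := k' + 1) fun x =>
      Subtype.ext (by
        rw [AddSubmonoidClass.coe_nsmul, ZeroMemClass.coe_zero]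
        exact galoisCohomology.nsmul_eq_zero_of_forall _
          (fun f => DiscreteGaloisModule.TateDual.nsmul_eq_zero f) x.1)
  -- `htr`: p11's scalar transport, its pair counts supplied by the level counts at the two depths
  have htr : ∀ k', k ≤ k' → ∀ (κ' : Finset (HeightOneSpectrum (𝓞 ℚ)) →
        galoisCohomology (W.torsionGaloisModule (((3 : ℕ) : ℤ) ^ k * ((3 : ℕ) : ℤ))) 1)
      (κu' : Finset (HeightOneSpectrum (𝓞 ℚ)) →
        galoisCohomology (W.torsionGaloisModule (((3 : ℕ) : ℤ) ^ k' * ((3 : ℕ) : ℤ))) 1)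
      (a a' : ℕ), κ' ∈ D.kolyvaginSystems (propagatedSelmerStructure W 3 k) →
        κu' ∈ (D' k').kolyvaginSystems (propagatedSelmerStructure W 3 k') →
        κ' = a • g → κu' = a' • g' k' →
        (∀ d, (D' k').IsLevel d → D.IsLevel d → galoisCohomology.map (red k') 1 (κu' d) = κ' d) →
        ∀ s, s ≤ k + 1 → (3 ^ s ∣ a ↔ 3 ^ s ∣ a') := by
    intro k' hk' κ' κu' a a' _ _ hκ' hκu' hcomp
    haveI := hfinT k
    haveI := hfinT k'
    haveI := hfinS k
    haveI := hfinS k'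
    -- the `Λ`-clauses at the two depths, from the two-level dictionary
    obtain ⟨κ₀, Λ, κ₀', κu₀, Λu, κu₀', hWk, hWk', -⟩ :=
      hdict k' hk' hk' (hred k') hadd hc3 hsurj ht hv₃ hcP hper
    obtain ⟨-, -, hon, hker, -⟩ := hWk
    obtain ⟨-, -, hon', hker', -⟩ := hWk'
    have hPT : ∀ d, D.IsLevel d →
        Nat.card (D.atLevel (propagatedSelmerStructure W 3 k) d).selmerGroup =
          3 ^ (k + 1) * Nat.card ((inv' k).dualSelmerStructure _
            (D.atLevel (propagatedSelmerStructure W 3 k) d)).selmerGroup := fun d hd =>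
      DeepLedger.natCard_selmerGroup_propagated_atLevel_eq W 3 k (by norm_num) hv₃ Λ hon hker
        (inv' k) (hperf' k) (hsum' k) (hcompl' k) (hinj' k) hEP (T k) (hv₃T k) (hT k) (h𝓕T k)
        (h𝓚T k) D hPS hUT hd
    have hPT' : ∀ d, (D' k').IsLevel d →
        Nat.card ((D' k').atLevel (propagatedSelmerStructure W 3 k') d).selmerGroup =
          3 ^ (k' + 1) * Nat.card ((inv' k').dualSelmerStructure _
            ((D' k').atLevel (propagatedSelmerStructure W 3 k') d)).selmerGroup := fun d hd =>
      DeepLedger.natCard_selmerGroup_propagated_atLevel_eq W 3 k' (by norm_num) hv₃ Λu hon' hker'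
        (inv' k') (hperf' k') (hsum' k') (hcompl' k') (hinj' k') hEP (T k') (hv₃T k') (hT k')
        (h𝓕T k') (h𝓚T k') (D' k') (hPS' k') (hUT' k') hd
    exact Transport.pow_dvd_iff_of_comp W hk' D (D' k') (red k') (hred k') hsurj hDT (hDT' k')
      (hPP' k' hk') (inv' k) (inv' k') hg (hg' k') (hgo' k') hR22D (hR22' k') hPT hPT' hκ' hκu' hcomp
  exact padicValRat_le_of_certificate_at W t k D v₃ hv₃ hadd hc3 hsurj ht hL P hcP hper g hgen D' red
    hred hdict g' hg' hgen' inv' hperf' hsum' hcompl' hinj' hEP T hv₃T hT h𝓕T h𝓚T hfinT hfinS hR22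
    hNp htr n hn htj hPN hψ₀ hcert hv

/-- **n1011's `Assembly.padicValRat_le_of_kolyvaginProduct_at` with the deep-family nesting binder
restricted to depths `k′ ≥ k`**; statement and proof otherwise verbatim (it calls
`padicValRat_le_of_certificate_of_transport_nested_at`).  (C20) at `p = 3` in Kim's ℕ-currency: the
shallow datum is a `τ`-datum (`D.primes = frobeniusClassPrimes ρ S τ 3^{k+1}`), `ρ_{E,3^{k+1}}` onto,
`n ∈ 𝒩_{k+1}` with the cyclicity flag and `ℓ ∤ N`, ONE system `ψ` of surjective discrete logarithms,
`δ̃^{(j)}_n(ψ) ≠ 0` and `δ̃^{(j)}_d(ψ) = 0` for `1 < d < n`, `d ∣ n`, `t + j ≤ k + 1` ⟹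
`∃ q, L(E,1)/Ω(W) = q ∧ ord₃ q ≤ ord₃ #Ш(E)(3) + (j − 1)` (adapted from
`Rank1Residual/GaloisImage/KuriharaLowerBoundThreeOfKolyvaginProductAt.lean`, credit cell b2b-bsdres n1011).
[cite: Kim2022StructureSelmer, Thm. 1.9 (6), §1.2.2 and §1.4.3] [cite: Sakamoto2024, §2 and Thm. 4.4]
[cite: MazurRubin2004, Thm. 3.2.4, Thm. 4.4.1 and App. A (33)] -/
theorem padicValRat_le_of_kolyvaginProduct_nested_at
    (W : WeierstrassCurve ℚ) [W.IsElliptic] [W.IsGloballyMinimal] (t k : ℕ)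
    (D : KolyvaginDatum (W.torsionGaloisModule (((3 : ℕ) : ℤ) ^ k * ((3 : ℕ) : ℤ))))
    (v₃ : HeightOneSpectrum (𝓞 ℚ)) (hv₃ : ((3 : ℕ) : 𝓞 ℚ) ∈ v₃.asIdeal)
    -- the row
    (hadd : Addv W 3) (hc3 : ¬ 3 ∣ (W.baseChange ℚ_[3]).localTamagawaNumber ℤ_[3])
    (hsurj : W.HasSurjectiveModNGaloisRep ((3 : ℕ) : ℤ))
    (ht : Nat.card {Q : (W.baseChange ℚ_[3]).toAffine.Point // (3 : ℕ) • Q = 0} = 3 ^ t)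
    (hL : W.entireLFunction 1 ≠ 0) [Finite W.toAffine.Point] [Finite W.sha]
    {N : ℕ} [NeZero N] (P : ModularParametrizationData W N) (hcP : ¬ ((3 : ℕ) : ℤ) ∣ P.maninConstant)
    (hper : ∃ u : ℚ, ‖(u : ℚ_[3])‖ = 1 ∧ W.realPeriodRat = u * plusPeriod P.f)
    -- the shallow datum: cyclotomic transverse condition, a generator `g` of `KS₁`, and Sakamoto's
    -- Thm. 4.4 (2) in ORDER form at every level (R1-22 instance)
    (hDT : D.transverse = cyclotomicTransverse _)
    (g : Finset (HeightOneSpectrum (𝓞 ℚ)) →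
      galoisCohomology (W.torsionGaloisModule (((3 : ℕ) : ℤ) ^ k * ((3 : ℕ) : ℤ))) 1)
    (hg : g ∈ D.kolyvaginSystems (propagatedSelmerStructure W 3 k))
    (hgen : ∀ κ ∈ D.kolyvaginSystems (propagatedSelmerStructure W 3 k), ∃ a : ℕ, κ = a • g)
    -- the deep inputs, at every depth `k′`
    (D' : ∀ k' : ℕ, KolyvaginDatum (W.torsionGaloisModule (((3 : ℕ) : ℤ) ^ k' * ((3 : ℕ) : ℤ))))
    (hDT' : ∀ k', (D' k').transverse = cyclotomicTransverse _)
    (hPP' : ∀ k', k ≤ k' → (D' k').primes ⊆ D.primes)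
    (red : ∀ k' : ℕ, (W.torsionGaloisModule (((3 : ℕ) : ℤ) ^ k' * ((3 : ℕ) : ℤ))).toContRepresentation
      →ⁱL (W.torsionGaloisModule (((3 : ℕ) : ℤ) ^ k * ((3 : ℕ) : ℤ))).toContRepresentation)
    (hred : ∀ k', ∀ x : geomTorsion W (((3 : ℕ) : ℤ) ^ k' * ((3 : ℕ) : ℤ)),
      ((red k' x : geomTorsion W (((3 : ℕ) : ℤ) ^ k * ((3 : ℕ) : ℤ))) : geomPoints W) =
        (((3 : ℕ) : ℤ) ^ (k' - k)) • (x : geomPoints W))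
    (hdict : ∀ k', k ≤ k' → KatoKuriharaDictionaryThreeAt₂At W t k k' D (D' k') (red k') v₃ P)
    (g' : ∀ k' : ℕ, Finset (HeightOneSpectrum (𝓞 ℚ)) →
      galoisCohomology (W.torsionGaloisModule (((3 : ℕ) : ℤ) ^ k' * ((3 : ℕ) : ℤ))) 1)
    (hg' : ∀ k', g' k' ∈ (D' k').kolyvaginSystems (propagatedSelmerStructure W 3 k'))
    (hgo' : ∀ k', addOrderOf (g' k') = 3 ^ (k' + 1))
    (hgen' : ∀ k', ∀ κ ∈ (D' k').kolyvaginSystems (propagatedSelmerStructure W 3 k'),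
      ∃ a : ℕ, κ = a • g' k')
    (inv' : ∀ k' : ℕ, LocalInvariants ℚ (3 ^ (k' + 1))) (hperf' : ∀ k', (inv' k').IsPerfect)
    (hsum' : ∀ k', (inv' k').SumLocalTermEqZero) (hcompl' : ∀ k', (inv' k').SelmerComplement)
    (hinj' : ∀ k', ∀ v : HeightOneSpectrum (𝓞 ℚ), Injective (inv' k' (Sum.inr v)))
    (hEP : ∀ v : HeightOneSpectrum (𝓞 ℚ), localEulerPoincareCharacteristic (v.adicCompletion ℚ))
    (T : ∀ k' : ℕ, Finset (HeightOneSpectrum (𝓞 ℚ))) (hv₃T : ∀ k', v₃ ∈ T k')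
    (hT : ∀ k', ∀ v : HeightOneSpectrum (𝓞 ℚ), v ∉ T k' →
      (((3 ^ (k' + 1) : ℕ) : ℕ) : 𝓞 ℚ) ∉ v.asIdeal ∧
        GaloisRep.IsUnramifiedAt v (W.torsionGaloisModule (((3 : ℕ) : ℤ) ^ k' * ((3 : ℕ) : ℤ))))
    (h𝓕T : ∀ k', (propagatedSelmerStructure W 3 k').IsUnramifiedOutside (finSupport (T k')))
    (h𝓚T : ∀ k', (W.kummerSelmerStructure (((3 : ℕ) : ℤ) ^ k' * ((3 : ℕ) : ℤ))).IsUnramifiedOutside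
      (finSupport (T k')))
    (hfinT : ∀ k', Finite (geomTorsion W (((3 : ℕ) : ℤ) ^ k' * ((3 : ℕ) : ℤ))))
    (hfinS : ∀ k', Finite (W.kummerSelmerStructure (((3 : ℕ) : ℤ) ^ k' * ((3 : ℕ) : ℤ))).selmerGroup)
    -- the primes of the data lie off the admissible sets and have Rubin's local shape
    (hPS : ∀ q ∈ D.primes, q ∉ T k) (hPS' : ∀ k', ∀ q ∈ (D' k').primes, q ∉ T k')
    (hUT : ∀ q ∈ D.primes,
      Nat.card (unramifiedSubgroup (GaloisRep.toLocal q
        (W.torsionGaloisModule (((3 : ℕ) : ℤ) ^ k * ((3 : ℕ) : ℤ)))) 1) =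
        Nat.card (D.transverse (Sum.inr q)))
    (hUT' : ∀ k', ∀ q ∈ (D' k').primes,
      Nat.card (unramifiedSubgroup (GaloisRep.toLocal q
        (W.torsionGaloisModule (((3 : ℕ) : ℤ) ^ k' * ((3 : ℕ) : ℤ)))) 1) =
        Nat.card ((D' k').transverse (Sum.inr q)))
    -- Sakamoto's Thm. 4.4 (2) in ORDER form at every level, shallow and deep (R1-22 / S24-DEEP)
    (hR22D : ∀ d, D.IsLevel d →
      (Nat.card ((inv' k).dualSelmerStructure _
          (D.atLevel (propagatedSelmerStructure W 3 k) d)).selmerGroup ∣ 3 ^ (k + 1) →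
        addOrderOf (g d) * Nat.card ((inv' k).dualSelmerStructure _
          (D.atLevel (propagatedSelmerStructure W 3 k) d)).selmerGroup = 3 ^ (k + 1)) ∧
      (3 ^ (k + 1) ∣ Nat.card ((inv' k).dualSelmerStructure _
          (D.atLevel (propagatedSelmerStructure W 3 k) d)).selmerGroup → g d = 0))
    (hR22' : ∀ k' d, (D' k').IsLevel d →
      (Nat.card ((inv' k').dualSelmerStructure _
          ((D' k').atLevel (propagatedSelmerStructure W 3 k') d)).selmerGroup ∣ 3 ^ (k' + 1) →
        addOrderOf (g' k' d) * Nat.card ((inv' k').dualSelmerStructure _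
          ((D' k').atLevel (propagatedSelmerStructure W 3 k') d)).selmerGroup = 3 ^ (k' + 1)) ∧
      (3 ^ (k' + 1) ∣ Nat.card ((inv' k').dualSelmerStructure _
          ((D' k').atLevel (propagatedSelmerStructure W 3 k') d)).selmerGroup → g' k' d = 0))
    -- the shallow datum is a `τ`-datum at level `3^{k+1}`, and `ρ_{E,3^{k+1}}` is onto
    {S : Set (HeightOneSpectrum (𝓞 ℚ))} {τ : absoluteGaloisGroup ℚ}
    (hτμ : τ ∈ rootsOfUnityFixer ℚ (3 ^ (k + 1)))
    (hτq : Nonempty (cokerSubOne (W.torsionGaloisModule (((3 : ℕ) : ℤ) ^ k * ((3 : ℕ) : ℤ))) τ ≃+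
      ZMod (3 ^ (k + 1))))
    (hDP : D.primes = frobeniusClassPrimes
      (W.torsionGaloisModule (((3 : ℕ) : ℤ) ^ k * ((3 : ℕ) : ℤ))) S τ (3 ^ (k + 1)))
    (hsurjK : W.HasSurjectiveModNGaloisRep (((3 : ℕ) : ℤ) ^ k * ((3 : ℕ) : ℤ)))
    -- the certificate in Kim's currency
    (n : ℕ) [NeZero n] (hn : Kato.IsKolyvaginProduct W 3 (k + 1) n)
    (hflag : ∀ v : HeightOneSpectrum (𝓞 ℚ), Ideal.absNorm v.asIdeal ∣ n →
      Nat.card (AddSubgroup.torsionBy (W.reductionAt v).toAffine.Point (3 : ℕ)) ≤ 3)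
    (hnS : ∀ v : HeightOneSpectrum (𝓞 ℚ), Ideal.absNorm v.asIdeal ∣ n → v ∉ S)
    (hnN : ∀ ℓ ∈ n.primeFactors, ¬ ℓ ∣ N) {j : ℕ} (htj : t + j ≤ k + 1)
    (ψ : (ℓ : ℕ) → (ZMod ℓ)ˣ →* Multiplicative (ZMod (3 ^ j)))
    (hψ : ∀ ℓ ∈ n.primeFactors, Function.Surjective (ψ ℓ))
    (hcert : kuriharaNumber P.f (3 ^ j) n ψ ≠ 0)
    (hv : ∀ d : ℕ, d ∣ n → 1 < d → d < n → ∀ [NeZero d], kuriharaNumber P.f (3 ^ j) d ψ = 0) :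
    ∃ q : ℚ, W.entireLFunction 1 / (W.realPeriodRat : ℂ) = (q : ℂ) ∧
      padicValRat 3 q ≤
        (padicValNat 3 (Nat.card (AddCommGroup.primaryComponent W.sha 3)) : ℤ) + ((j - 1 : ℕ) : ℤ) := by
  haveI : Fact (Nat.Prime 3) := ⟨Nat.prime_three⟩
  -- the places of `n` form a level of `D`
  obtain ⟨nF, hsub, hprod, hmem⟩ := FrobShape.exists_level_of_kolyvaginProduct W 3
    (Nat.succ_pos k) hn hflag (((3 : ℕ) : ℤ) ^ k * ((3 : ℕ) : ℤ)) (by push_cast; rw [pow_succ]) hsurjK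
    hτμ hτq hnS
  have hlev : D.IsLevel nF := by
    change (↑nF : Set _) ⊆ D.primes
    rw [hDP]
    exact hsub
  have hprime : ∀ q ∈ nF, (Ideal.absNorm q.asIdeal).Prime := fun q hq =>
    Nat.prime_of_mem_primeFactors (hmem q hq)
  have hinj := absNorm_injOn (↑nF : Set (HeightOneSpectrum (𝓞 ℚ)))
  have hn0 : n ≠ 0 := hn.ne_zero
  -- sub-products are divisors of `n`
  have hdvd : ∀ c ⊆ nF, (∏ q ∈ c, Ideal.absNorm q.asIdeal) ∣ n := fun c hc => by
    rw [← hprod]; exact Finset.prod_dvd_prod_of_subset _ _ _ hc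
  refine padicValRat_le_of_certificate_of_transport_nested_at W t k D v₃ hv₃ hadd hc3 hsurj ht hL P hcP hper
    hDT g hg hgen D' hDT' hPP' red hred hdict g' hg' hgo' hgen' inv' hperf' hsum' hcompl' hinj' hEP
    T hv₃T hT h𝓕T h𝓚T hfinT hfinS hPS hPS' hUT hUT' hR22D hR22' nF hlev htj ?_ (ψ₀ := ψ) ?_ ?_ ?_
  · -- `N q ∤ N`
    intro q hq
    exact (Nat.Prime.coprime_iff_not_dvd (hprime q hq)).mpr (hnN _ (hmem q hq))
  · exact fun q hq => hψ _ (hmem q hq)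
  · -- the certificate at `n = ∏ N q`
    rw [kuriharaNumber_congr_level P.f (3 ^ j) hprod _ inferInstance ψ]
    exact hcert
  · -- the proper non-empty sub-levels: proper divisors `1 < d < n`, any surjective `ψ′`
    intro c hc hne ψ' hψ'
    set d := ∏ q ∈ c, Ideal.absNorm q.asIdeal with hd
    have hd0 : d ≠ 0 := Finset.prod_ne_zero_iff.2 fun q _ => absNorm_ne_zero q
    haveI : NeZero d := ⟨hd0⟩
    have hdn : d ∣ n := hdvd c hc.subset
    have h1d : 1 < d := by
      obtain ⟨q₀, hq₀⟩ := hne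
      have hle : Ideal.absNorm q₀.asIdeal ≤ d :=
        Nat.le_of_dvd (Nat.pos_of_ne_zero hd0) (Finset.dvd_prod_of_mem _ hq₀)
      exact lt_of_lt_of_le (hprime q₀ (hc.subset hq₀)).one_lt hle
    have hdlt : d < n := by
      have hsd : (nF \ c).Nonempty := Finset.sdiff_nonempty.mpr hc.not_subset
      obtain ⟨q₁, hq₁⟩ := hsd
      have hsplit := Finset.prod_sdiff (f := fun q => Ideal.absNorm q.asIdeal) hc.subset
      rw [hprod] at hsplit
      have h1 : 1 < ∏ q ∈ nF \ c, Ideal.absNorm q.asIdeal := by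
        have hle : Ideal.absNorm q₁.asIdeal ≤ ∏ q ∈ nF \ c, Ideal.absNorm q.asIdeal :=
          Nat.le_of_dvd (Nat.pos_of_ne_zero (Finset.prod_ne_zero_iff.2 fun q _ => absNorm_ne_zero q))
            (Finset.dvd_prod_of_mem _ hq₁)
        exact lt_of_lt_of_le (hprime q₁ (Finset.sdiff_subset hq₁)).one_lt hle
      calc d = 1 * d := (one_mul d).symm
        _ < (∏ q ∈ nF \ c, Ideal.absNorm q.asIdeal) * d := Nat.mul_lt_mul_of_pos_right h1
            (Nat.pos_of_ne_zero hd0)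
        _ = n := hsplit
    have hzero : kuriharaNumber P.f (3 ^ j) d ψ = 0 := hv d hdn h1d hdlt
    -- `δ̃_d(ψ′) = u · δ̃_d(ψ)` for a unit `u`
    have hψd : ∀ ℓ ∈ d.primeFactors, Function.Surjective (ψ ℓ) := fun ℓ hℓ =>
      hψ ℓ (Nat.primeFactors_mono hdn hn0 hℓ)
    have hψ'd : ∀ ℓ ∈ d.primeFactors, Function.Surjective (ψ' ℓ) :=
      Shallow.forall_primeFactors_of_forall_mem (fun q : HeightOneSpectrum (𝓞 ℚ) =>
        Ideal.absNorm q.asIdeal) c (fun q hq => hprime q (hc.subset hq)) (hinj.mono hc.subset) hψ'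
    obtain ⟨u, hu⟩ := exists_units_kuriharaNumber_eq_mul P.f (3 ^ j) d hψd hψ'd
    change kuriharaNumber P.f (3 ^ j) d ψ' = 0
    rw [hu, hzero, mul_zero]

end Summit.BirchSwinnertonDyer.BirchSwinnertonDyer.Theorems.KimAtThreeKolyvaginDeepLowerNestedEnd

end
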